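import Summits.CriticalPhenomena.PercolationContinuityZ3.Theorems.Transplant.SkeletonDropNode
import Summits.CriticalPhenomena.PercolationContinuityZ3.Theorems.Transplant.ThetaDropBoxProdZ2
import Literature.Probability.Percolation.RegionGluing
import HarnessLib

/-!
# The node hierarchy made explicit: the GENERAL drop node over planar skeletons implies the PRODUCT drop node
# (`SamePDropOfSkeleton → ThetaDropBoxProdZ2`); the converse is NOT claimed

builds on p205010 (kernel theorem, internal audit signed; external expert review pending).
Status sentence (coordinator 2026-08-20T04:30Z): "θ(p_c) = 0 on ℤ^d, all d ≥ 2 — kernel-verified (Lean 4/Mathlib,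
standard axioms); internal adversarial audit SIGNED 2026-08-20 04:29Z; external expert review pending."

Lane `prim-bschramm`, seat `prim-bschramm-p5` (gen 3; the lane's refuter — honest-framing guard, P5-SHARPNESS.md §19.1 "TWO NODES"),
helper file (`--supports stmt-CriticalPhenomena-4575`).

The lane carries two `@[conjecture]` drop nodes: the GENERAL one, `SamePDropOfSkeleton` (SkeletonDropNode, p219198: universal over
ALL graphs with a `PlanarSkeleton`, sheared skeletons such as `H₃(ℤ)` and `H₃(ℤ) × ℤ` included), and the PRODUCT one,
`ThetaDropBoxProdZ2` (p219373: `X □ ℤ²` for `X` infinite, connected, quasi-transitive, amenable), which is the target of the design-(D)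
typing (`BoxProdZ2DropAssembly`).  This file records the ONE implication that holds by instantiation — every `X □ ℤ²` carries the product
skeleton `boxProdZ2Skeleton` (φ = `Prod.snd`), whose cylinders at a base root are the tubes `X × {-ℓ,…,ℓ}²` (`cyl_boxProdZ2Skeleton`), so
`TubeSubcritical X p` is exactly input Φ2 there, and positivity of `θ` is transported between the root `(w,0)` and a base root `(v₀,0)` along
the connected product graph.  Consequently a proof of `ThetaDropBoxProdZ2` does NOT by itself discharge the rungs that are conditional on the
general node (`heisenbergCriticalContinuity_of_dropNode`, `heisenbergZCriticalContinuity_of_dropNode`); the converse implication is not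
claimed anywhere in the tree.  Neither node is asserted here.
[cite: KozmaNitzan2024, §1 p. 2 (approach 1), §4] [cite: BenjaminiSchramm1996, Conj. 4]
-/

noncomputable section

namespace Summit.CriticalPhenomena.PercolationContinuityZ3.Theorems.Transplant

open MeasureTheory Literature.Probability.Percolation Literature.Probability.LatticeModels
open Literature.Barriers.CriticalPhenomena (IsQuasiTransitive IsGraphAmenable countable_of_connected_of_locallyFinite)

/-- **The general drop node implies the product drop node.**  Given `SamePDropOfSkeleton`, every `X □ ℤ²` (`X` connected,
locally finite, quasi-transitive; amenability and infinitude are part of the product node's binder but not used) satisfies the drop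
statement: uniqueness at `p`, tube-subcriticality at `p` and `θ_{(w,0)}(p) > 0` give some `q < p` with `θ_{(w,0)}(q) > 0`.
The converse is NOT claimed. [cite: KozmaNitzan2024, §1 p. 2 (approach 1)] -/
theorem thetaDropBoxProdZ2_of_samePDropOfSkeleton (hD : SamePDropOfSkeleton) : ThetaDropBoxProdZ2 := by
  intro W _ X _ hc hq _ _ w p hU hT hθ
  have hconn : (X □ zdGraph 2).Connected := connected_boxProd_zdGraph hc 2
  haveI : Countable (W × Site 2) := countable_of_connected_of_locallyFinite (X □ zdGraph 2) hconn (w, 0)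
  obtain ⟨t, ht, -, -, -⟩ := (boxProdZ2Skeleton X hq).frame (w, (0 : Site 2))
  obtain ⟨v₀, -, rfl⟩ := Finset.mem_image.1 ht
  -- input Φ2 of the product skeleton at `p` is tube-subcriticality at `p`
  have hC : (boxProdZ2Skeleton X hq).CylSubcritical p := by
    intro t' ht' ℓ
    obtain ⟨v₁, -, rfl⟩ := Finset.mem_image.1 ht'
    rw [theta_induce_congr (X □ zdGraph 2) (cyl_boxProdZ2Skeleton X hq v₁ ℓ)]
    exact hT ℓ v₁
  -- transport positivity of `θ` to the base root, drop there, transport back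
  have hθ₀ : 0 < theta (X □ zdGraph 2) (v₀, (0 : Site 2)) p :=
    RegionGluing.theta_pos_of_reachable_root (X □ zdGraph 2) (hconn.preconnected _ _) p hθ
  obtain ⟨q, hqp, hq0⟩ := hD (X □ zdGraph 2) (boxProdZ2Skeleton X hq) hconn _ ht p hU hC hθ₀
  exact ⟨q, hqp, RegionGluing.theta_pos_of_reachable_root (X □ zdGraph 2) (hconn.preconnected _ _) q hq0⟩

/-- Hence the general WITNESS node also implies the product drop node (through `samePDropOfSkeleton_of_witness`).
[cite: KozmaNitzan2024, §1 p. 2 (approach 1)] -/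
theorem thetaDropBoxProdZ2_of_samePWitnessOfSkeleton (hW : SamePWitnessOfSkeleton) : ThetaDropBoxProdZ2 :=
  thetaDropBoxProdZ2_of_samePDropOfSkeleton (samePDropOfSkeleton_of_witness hW)

end Summit.CriticalPhenomena.PercolationContinuityZ3.Theorems.Transplant

end
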